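import Mathlib
import Summits.NavierStokesRegularity.NavierStokesRegularity.Theorems.EulerZoomLiouvillePowerGaugeEulerLiouvilleHoopDensityBound
import Summits.NavierStokesRegularity.NavierStokesRegularity.Theorems.EulerZoomLiouvillePowerGaugeEulerLiouvilleHoopCylinder

/-!
# HOOP LINE, calculus plate: derivatives and continuity of the azimuthal average `HoopCore.circleAvg` in height and radius (LEAD 19832 g14; for AX-2 / AX-4)

Class-free tool for crux `EulerZoomLiouville.PowerGaugeEulerLiouville` (stmt-NavierStokesRegularity-19832), the hoop / axis-law line of ns-idea-11 g8's HOOP NOTE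
(objects `…HoopDefs` p686329; frame `…HoopFrame` p686819 / `…HoopDensityBound` p687085, ns-ezl-w3 g6; cylinder `…HoopCylinder` p687163, ns-sfl-p1 g7).  LEAD ns-typeII-p2 g14,
`--supports stmt-NavierStokesRegularity-19832 --as helper`.

For `f ∈ C¹(ℝ³; ℝ)` and `circleAvg f s t = (2π)⁻¹ ∫₀^{2π} f(axisPt s t θ) dθ`:
* `hasDerivAt_axisPt_height` / `hasDerivAt_axisPt_radius'` — `∂_s axisPt = e_z`, `∂_t axisPt = R_θ e₀` (all `t`);
* `hasDerivAt_circleAvg_height` — `∂_s circleAvg f s t = circleAvg (∂_{e_z} f) s t` (every `t`; differentiation under the integral, the derivative bounded on a compact cylinder);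
* `hasDerivAt_circleAvg_radius` — `∂_t circleAvg f s t = circleAvg (y ↦ Df(y)[e_r(y)]) s t` for `t > 0` (`e_r(axisPt s t θ) = R_θ e₀`, `…HoopFrame.eR_axisPt`);
* `continuous_circleAvg` — joint continuity in `(s, t)` for continuous `f`.
These are the parametric-integral steps of the K-AXIS plates AX-2 (circle-averaged radial law) and AX-4 (`endTerm` is `C¹` in the height; FTC ⇒ `AxisLawIntegrated`).
WHAT THIS IS NOT: not NS, not E — calculus; 19832 OPEN; NS regularity NOT proved. [folklore (differentiation under the integral sign)]
-/

noncomputable section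

open Set Function WithLp MeasureTheory intervalIntegral Metric
open scoped InnerProductSpace RealInnerProductSpace Topology

set_option linter.dupNamespace false

namespace Summit.NavierStokesRegularity.NavierStokesRegularity.Theorems.PowerGaugeEulerLiouville.HoopCore

open Literature.Analysis Literature.Analysis.FluidPDE

/-! ## The circle point as a function of height and radius -/

/-- `∂_s axisPt s t θ = e_z`. [folklore] -/
theorem hasDerivAt_axisPt_height (s t θ : ℝ) : HasDerivAt (fun s => axisPt s t θ) eZ s := by
  have h : (fun s => axisPt s t θ) = fun s => s • eZ + t • rotZ θ (EuclideanSpace.single (0 : Fin 3) (1 : ℝ)) := by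
    funext s; exact axisPt_eq_axis_add s t θ
  rw [h]
  simpa using ((hasDerivAt_id s).smul_const eZ).add_const (t • rotZ θ (EuclideanSpace.single (0 : Fin 3) (1 : ℝ)))

/-- `∂_t axisPt s t θ = R_θ e₀` (every `t`, no sign condition). [folklore] -/
theorem hasDerivAt_axisPt_radius' (s t θ : ℝ) :
    HasDerivAt (fun t => axisPt s t θ) (rotZ θ (EuclideanSpace.single (0 : Fin 3) (1 : ℝ))) t := by
  have h : (fun t => axisPt s t θ) = fun t => s • eZ + t • rotZ θ (EuclideanSpace.single (0 : Fin 3) (1 : ℝ)) := by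
    funext t; exact axisPt_eq_axis_add s t θ
  rw [h]
  simpa using ((hasDerivAt_id t).smul_const (rotZ θ (EuclideanSpace.single (0 : Fin 3) (1 : ℝ)))).const_add (s • eZ)

/-- Chain rule in the height: `∂_s f(axisPt s t θ) = Df(axisPt s t θ)[e_z]`. [folklore] -/
theorem hasDerivAt_comp_axisPt_height {f : EuclideanSpace ℝ (Fin 3) → ℝ} (hf : Differentiable ℝ f) (s t θ : ℝ) :
    HasDerivAt (fun s => f (axisPt s t θ)) (fderiv ℝ f (axisPt s t θ) eZ) s :=
  ((hf _).hasFDerivAt.comp_hasDerivAt s (hasDerivAt_axisPt_height s t θ))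

/-- Chain rule in the radius: `∂_t f(axisPt s t θ) = Df(axisPt s t θ)[R_θ e₀]`. [folklore] -/
theorem hasDerivAt_comp_axisPt_radius {f : EuclideanSpace ℝ (Fin 3) → ℝ} (hf : Differentiable ℝ f) (s t θ : ℝ) :
    HasDerivAt (fun t => f (axisPt s t θ)) (fderiv ℝ f (axisPt s t θ) (rotZ θ (EuclideanSpace.single (0 : Fin 3) (1 : ℝ)))) t :=
  ((hf _).hasFDerivAt.comp_hasDerivAt t (hasDerivAt_axisPt_radius' s t θ))

/-- Continuity of the circle point in `(height, angle)` at fixed radius (componentwise, via `axisPt_eq_toLp`). [folklore] -/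
theorem continuous_axisPt_height_angle (t : ℝ) : Continuous fun p : ℝ × ℝ => axisPt p.1 t p.2 := by
  simp_rw [axisPt_eq_toLp]
  refine (PiLp.continuous_toLp 2 _).comp (continuous_pi fun i => ?_)
  fin_cases i
  · exact continuous_const.mul (Real.continuous_cos.comp continuous_snd)
  · exact continuous_const.mul (Real.continuous_sin.comp continuous_snd)
  · exact continuous_fst

/-- Continuity of the circle point in `(radius, angle)` at fixed height. [folklore] -/
theorem continuous_axisPt_radius_angle (s : ℝ) : Continuous fun p : ℝ × ℝ => axisPt s p.1 p.2 := by
  simp_rw [axisPt_eq_toLp]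
  refine (PiLp.continuous_toLp 2 _).comp (continuous_pi fun i => ?_)
  fin_cases i
  · exact continuous_fst.mul (Real.continuous_cos.comp continuous_snd)
  · exact continuous_fst.mul (Real.continuous_sin.comp continuous_snd)
  · exact continuous_const

/-- Continuity of the circle point in the angle. [folklore] -/
theorem continuous_axisPt_angle (s t : ℝ) : Continuous fun θ : ℝ => axisPt s t θ := by
  simp_rw [axisPt_eq_toLp]
  refine (PiLp.continuous_toLp 2 _).comp (continuous_pi fun i => ?_)
  fin_cases i
  · exact continuous_const.mul Real.continuous_cos
  · exact continuous_const.mul Real.continuous_sin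
  · exact continuous_const

/-- Continuity of `((s,t),θ) ↦ axisPt s t θ` (the association used by parametric interval integrals). [folklore] -/
theorem continuous_axisPt_uncurry : Continuous fun q : (ℝ × ℝ) × ℝ => axisPt q.1.1 q.1.2 q.2 := by
  simp_rw [axisPt_eq_toLp]
  refine (PiLp.continuous_toLp 2 _).comp (continuous_pi fun i => ?_)
  fin_cases i
  · exact (continuous_snd.comp continuous_fst).mul (Real.continuous_cos.comp continuous_snd)
  · exact (continuous_snd.comp continuous_fst).mul (Real.continuous_sin.comp continuous_snd)
  · exact continuous_fst.comp continuous_fst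

/-! ## Continuity of the azimuthal average -/

/-- **Joint continuity of `circleAvg f` in `(s, t)`** for continuous `f`. [folklore] -/
theorem continuous_circleAvg {f : EuclideanSpace ℝ (Fin 3) → ℝ} (hf : Continuous f) :
    Continuous fun p : ℝ × ℝ => circleAvg f p.1 p.2 := by
  have hF : Continuous fun q : (ℝ × ℝ) × ℝ => f (axisPt q.1.1 q.1.2 q.2) := hf.comp continuous_axisPt_uncurry
  have hI : Continuous fun p : ℝ × ℝ => ∫ θ in (0 : ℝ)..(2 * Real.pi), f (axisPt p.1 p.2 θ) :=
    intervalIntegral.continuous_parametric_intervalIntegral_of_continuous' hF 0 (2 * Real.pi)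
  exact continuous_const.mul hI

/-- Continuity of `s ↦ circleAvg f s t` for continuous `f`. [folklore] -/
theorem continuous_circleAvg_height {f : EuclideanSpace ℝ (Fin 3) → ℝ} (hf : Continuous f) (t : ℝ) :
    Continuous fun s : ℝ => circleAvg f s t := by
  have hF : Continuous fun q : ℝ × ℝ => f (axisPt q.1 t q.2) := hf.comp (continuous_axisPt_height_angle t)
  have hI : Continuous fun s : ℝ => ∫ θ in (0 : ℝ)..(2 * Real.pi), f (axisPt s t θ) :=
    intervalIntegral.continuous_parametric_intervalIntegral_of_continuous' hF 0 (2 * Real.pi)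
  exact continuous_const.mul hI

/-- Continuity of `t ↦ circleAvg f s t` for continuous `f`. [folklore] -/
theorem continuous_circleAvg_radius {f : EuclideanSpace ℝ (Fin 3) → ℝ} (hf : Continuous f) (s : ℝ) :
    Continuous fun t : ℝ => circleAvg f s t := by
  have hF : Continuous fun q : ℝ × ℝ => f (axisPt s q.1 q.2) := hf.comp (continuous_axisPt_radius_angle s)
  have hI : Continuous fun t : ℝ => ∫ θ in (0 : ℝ)..(2 * Real.pi), f (axisPt s t θ) :=
    intervalIntegral.continuous_parametric_intervalIntegral_of_continuous' hF 0 (2 * Real.pi)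
  exact continuous_const.mul hI

/-! ## Differentiation under the azimuthal integral -/

/-- A uniform bound for `‖Df‖` along a continuous two-parameter family of points over the compact box `[a−1, a+1] × [0, 2π]`. [folklore] -/
theorem exists_bound_fderiv_comp {f : EuclideanSpace ℝ (Fin 3) → ℝ} (hf : ContDiff ℝ 1 f) {g : ℝ → ℝ → EuclideanSpace ℝ (Fin 3)}
    (hg : Continuous fun p : ℝ × ℝ => g p.1 p.2) (a : ℝ) :
    ∃ M : ℝ, ∀ x ∈ Icc (a - 1) (a + 1), ∀ θ ∈ Icc (0 : ℝ) (2 * Real.pi), ‖fderiv ℝ f (g x θ)‖ ≤ M := by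
  have hK : IsCompact (Icc (a - 1) (a + 1) ×ˢ Icc (0 : ℝ) (2 * Real.pi)) := isCompact_Icc.prod isCompact_Icc
  have hc : ContinuousOn (fun p : ℝ × ℝ => fderiv ℝ f (g p.1 p.2)) (Icc (a - 1) (a + 1) ×ˢ Icc (0 : ℝ) (2 * Real.pi)) :=
    ((hf.continuous_fderiv one_ne_zero).comp hg).continuousOn
  obtain ⟨M, hM⟩ := hK.exists_bound_of_continuousOn hc
  exact ⟨M, fun x hx θ hθ => hM (x, θ) ⟨hx, hθ⟩⟩

/-- **Differentiation of `circleAvg` in the HEIGHT**: for `f ∈ C¹`, `∂_s circleAvg f s t = circleAvg (y ↦ Df(y)[e_z]) s t` (every `t`). [folklore] -/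
theorem hasDerivAt_circleAvg_height {f : EuclideanSpace ℝ (Fin 3) → ℝ} (hf : ContDiff ℝ 1 f) (s t : ℝ) :
    HasDerivAt (fun s => circleAvg f s t) (circleAvg (fun y => fderiv ℝ f y eZ) s t) s := by
  have hfd : Differentiable ℝ f := hf.differentiable one_ne_zero
  have hfc : Continuous f := hf.continuous
  -- uniform bound on the derivative over `x ∈ [s−1, s+1]`, `θ ∈ [0, 2π]`
  obtain ⟨M, hM⟩ := exists_bound_fderiv_comp hf (g := fun x θ => axisPt x t θ) (continuous_axisPt_height_angle t) s
  have key := intervalIntegral.hasDerivAt_integral_of_dominated_loc_of_deriv_le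
    (F := fun x θ => f (axisPt x t θ)) (F' := fun x θ => fderiv ℝ f (axisPt x t θ) eZ) (x₀ := s)
    (a := 0) (b := 2 * Real.pi) (bound := fun _ => M * ‖eZ‖) (μ := volume) (s := Metric.ball s 1) (Metric.ball_mem_nhds s zero_lt_one) ?_ ?_ ?_ ?_ ?_ ?_
  · have h2 := key.2.const_mul (1 / (2 * Real.pi))
    simpa [circleAvg] using h2
  · exact Filter.Eventually.of_forall fun x =>
      ((hfc.comp (continuous_axisPt_angle _ _)).aestronglyMeasurable)
  · exact ((hfc.comp (continuous_axisPt_angle _ _)).intervalIntegrable _ _)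
  · exact (((hf.continuous_fderiv one_ne_zero).comp
      (continuous_axisPt_angle _ _)).clm_apply continuous_const).aestronglyMeasurable
  · refine Filter.Eventually.of_forall fun θ hθ x hx => ?_
    have hθ' : θ ∈ Icc (0 : ℝ) (2 * Real.pi) := by
      rw [uIoc_of_le (by positivity)] at hθ
      exact ⟨hθ.1.le, hθ.2⟩
    have hx' : x ∈ Icc (s - 1) (s + 1) := by
      rw [mem_ball, Real.dist_eq] at hx
      constructor <;> linarith [abs_lt.1 hx]
    exact (ContinuousLinearMap.le_opNorm _ _).trans (mul_le_mul_of_nonneg_right (hM x hx' θ hθ') (norm_nonneg _))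
  · exact intervalIntegrable_const
  · exact Filter.Eventually.of_forall fun θ _ x _ => hasDerivAt_comp_axisPt_height hfd x t θ

/-- **Differentiation of `circleAvg` in the RADIUS**: for `f ∈ C¹` and `t > 0`, `∂_t circleAvg f s t = circleAvg (y ↦ Df(y)[e_r(y)]) s t`. [folklore] -/
theorem hasDerivAt_circleAvg_radius {f : EuclideanSpace ℝ (Fin 3) → ℝ} (hf : ContDiff ℝ 1 f) (s : ℝ) {t : ℝ} (ht : 0 < t) :
    HasDerivAt (fun t => circleAvg f s t) (circleAvg (fun y => fderiv ℝ f y (eR y)) s t) t := by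
  have hfd : Differentiable ℝ f := hf.differentiable one_ne_zero
  have hfc : Continuous f := hf.continuous
  obtain ⟨M, hM⟩ := exists_bound_fderiv_comp hf (g := fun x θ => axisPt s x θ) (continuous_axisPt_radius_angle s) t
  have key := intervalIntegral.hasDerivAt_integral_of_dominated_loc_of_deriv_le
    (F := fun x θ => f (axisPt s x θ)) (F' := fun x θ => fderiv ℝ f (axisPt s x θ) (rotZ θ (EuclideanSpace.single (0 : Fin 3) (1 : ℝ))))
    (x₀ := t) (a := 0) (b := 2 * Real.pi) (bound := fun _ => M) (μ := volume) (s := Metric.ball t 1) (Metric.ball_mem_nhds t zero_lt_one) ?_ ?_ ?_ ?_ ?_ ?_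
  · have h2 := key.2.const_mul (1 / (2 * Real.pi))
    -- replace `R_θ e₀` by `e_r(axisPt s t θ)` inside the average (valid since `t > 0`)
    have hcongr : ∫ θ in (0 : ℝ)..(2 * Real.pi), fderiv ℝ f (axisPt s t θ) (rotZ θ (EuclideanSpace.single (0 : Fin 3) (1 : ℝ))) =
        ∫ θ in (0 : ℝ)..(2 * Real.pi), fderiv ℝ f (axisPt s t θ) (eR (axisPt s t θ)) :=
      intervalIntegral.integral_congr fun θ _ => by simp only [eR_axisPt s ht θ]
    rw [hcongr] at h2
    simpa [circleAvg] using h2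
  · exact Filter.Eventually.of_forall fun x =>
      ((hfc.comp (continuous_axisPt_angle _ _)).aestronglyMeasurable)
  · exact ((hfc.comp (continuous_axisPt_angle _ _)).intervalIntegrable _ _)
  · have hc1 : Continuous fun θ : ℝ => fderiv ℝ f (axisPt s t θ) :=
      (hf.continuous_fderiv one_ne_zero).comp (continuous_axisPt_angle s t)
    have hc2 : Continuous fun θ : ℝ => rotZ θ (EuclideanSpace.single (0 : Fin 3) (1 : ℝ)) := by
      have := (continuous_eR_axisPt s ht)
      exact this.congr fun θ => eR_axisPt s ht θ
    exact (hc1.clm_apply hc2).aestronglyMeasurable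
  · refine Filter.Eventually.of_forall fun θ hθ x hx => ?_
    have hθ' : θ ∈ Icc (0 : ℝ) (2 * Real.pi) := by
      rw [uIoc_of_le (by positivity)] at hθ
      exact ⟨hθ.1.le, hθ.2⟩
    have hx' : x ∈ Icc (t - 1) (t + 1) := by
      rw [mem_ball, Real.dist_eq] at hx
      constructor <;> linarith [abs_lt.1 hx]
    calc ‖fderiv ℝ f (axisPt s x θ) (rotZ θ (EuclideanSpace.single (0 : Fin 3) (1 : ℝ)))‖
        ≤ ‖fderiv ℝ f (axisPt s x θ)‖ * ‖rotZ θ (EuclideanSpace.single (0 : Fin 3) (1 : ℝ))‖ := ContinuousLinearMap.le_opNorm _ _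
      _ ≤ M * 1 := by
          rw [norm_rotZ_single_zero]
          exact mul_le_mul_of_nonneg_right (hM x hx' θ hθ') zero_le_one
      _ = M := mul_one M
  · exact intervalIntegrable_const
  · exact Filter.Eventually.of_forall fun θ _ x _ => hasDerivAt_comp_axisPt_radius hfd s x θ

/-! ## Localised versions: `f` of class `C¹` only on an OPEN SET containing the circles (e.g. off the axis, for `radialVelocity`/`swirlVelocity` integrands)

Appended by LEAD g14: the `endTerm`/`endTermC` integrands of the axis law contain `radialVelocity V y = ⟪V y, e_r y⟫`, which is `C¹` only off the axis
`{cylRadius ≠ 0}`; for `t ≠ 0` every circle `axisPt x t ·` stays off the axis, so the localised statements below are the ones AX-4 consumes. -/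

/-- A uniform bound for `‖Df‖` along a continuous two-parameter family staying inside an open set `U` on which `f` is `C¹`. [folklore] -/
theorem exists_bound_fderiv_comp_of_contDiffOn {f : EuclideanSpace ℝ (Fin 3) → ℝ} {U : Set (EuclideanSpace ℝ (Fin 3))} (hU : IsOpen U)
    (hf : ContDiffOn ℝ 1 f U) {g : ℝ → ℝ → EuclideanSpace ℝ (Fin 3)} (hg : Continuous fun p : ℝ × ℝ => g p.1 p.2) (a : ℝ)
    (hgU : ∀ x ∈ Icc (a - 1) (a + 1), ∀ θ ∈ Icc (0 : ℝ) (2 * Real.pi), g x θ ∈ U) :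
    ∃ M : ℝ, ∀ x ∈ Icc (a - 1) (a + 1), ∀ θ ∈ Icc (0 : ℝ) (2 * Real.pi), ‖fderiv ℝ f (g x θ)‖ ≤ M := by
  have hK : IsCompact (Icc (a - 1) (a + 1) ×ˢ Icc (0 : ℝ) (2 * Real.pi)) := isCompact_Icc.prod isCompact_Icc
  have hcf : ContinuousOn (fderiv ℝ f) U := hf.continuousOn_fderiv_of_isOpen hU le_rfl
  have hmaps : MapsTo (fun p : ℝ × ℝ => g p.1 p.2) (Icc (a - 1) (a + 1) ×ˢ Icc (0 : ℝ) (2 * Real.pi)) U :=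
    fun p hp => hgU p.1 hp.1 p.2 hp.2
  have hc : ContinuousOn (fun p : ℝ × ℝ => fderiv ℝ f (g p.1 p.2)) (Icc (a - 1) (a + 1) ×ˢ Icc (0 : ℝ) (2 * Real.pi)) :=
    hcf.comp hg.continuousOn hmaps
  obtain ⟨M, hM⟩ := hK.exists_bound_of_continuousOn hc
  exact ⟨M, fun x hx θ hθ => hM (x, θ) ⟨hx, hθ⟩⟩

/-- **Differentiation of `circleAvg` in the HEIGHT, localised**: `f` is `C¹` on an open set `U` containing the circles `axisPt x t ·`, `x ∈ [s−1, s+1]` (e.g.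
`U = {cylRadius ≠ 0}`, `t ≠ 0`). [folklore] -/
theorem hasDerivAt_circleAvg_height_of_contDiffOn {f : EuclideanSpace ℝ (Fin 3) → ℝ} {U : Set (EuclideanSpace ℝ (Fin 3))} (hU : IsOpen U)
    (hf : ContDiffOn ℝ 1 f U) (s t : ℝ) (hsub : ∀ x ∈ Icc (s - 1) (s + 1), ∀ θ : ℝ, axisPt x t θ ∈ U) :
    HasDerivAt (fun s => circleAvg f s t) (circleAvg (fun y => fderiv ℝ f y eZ) s t) s := by
  have hdiff : ∀ x ∈ Icc (s - 1) (s + 1), ∀ θ : ℝ, DifferentiableAt ℝ f (axisPt x t θ) := fun x hx θ =>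
    (hf.differentiableOn one_ne_zero _ (hsub x hx θ)).differentiableAt (hU.mem_nhds (hsub x hx θ))
  have hcontU : ContinuousOn f U := hf.continuousOn
  -- continuity of the integrands along the circles, for `x ∈ [s−1, s+1]`
  have hcontF : ∀ x ∈ Icc (s - 1) (s + 1), Continuous fun θ : ℝ => f (axisPt x t θ) := by
    intro x hx
    have h1 : Continuous fun θ : ℝ => axisPt x t θ := continuous_axisPt_angle x t
    exact (hcontU.comp_continuous h1 fun θ => hsub x hx θ)
  have hcontF' : Continuous fun θ : ℝ => fderiv ℝ f (axisPt s t θ) eZ := by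
    have h1 : Continuous fun θ : ℝ => axisPt s t θ := continuous_axisPt_angle s t
    have hs : s ∈ Icc (s - 1) (s + 1) := ⟨by linarith, by linarith⟩
    exact ((hf.continuousOn_fderiv_of_isOpen hU le_rfl).comp_continuous h1 fun θ => hsub s hs θ).clm_apply continuous_const
  obtain ⟨M, hM⟩ := exists_bound_fderiv_comp_of_contDiffOn hU hf (g := fun x θ => axisPt x t θ) (continuous_axisPt_height_angle t) s
    (fun x hx θ _ => hsub x hx θ)
  have hball : ∀ x ∈ Metric.ball s 1, x ∈ Icc (s - 1) (s + 1) := fun x hx => by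
    rw [mem_ball, Real.dist_eq] at hx
    constructor <;> linarith [abs_lt.1 hx]
  have key := intervalIntegral.hasDerivAt_integral_of_dominated_loc_of_deriv_le
    (F := fun x θ => f (axisPt x t θ)) (F' := fun x θ => fderiv ℝ f (axisPt x t θ) eZ) (x₀ := s)
    (a := 0) (b := 2 * Real.pi) (bound := fun _ => M * ‖eZ‖) (μ := volume) (s := Metric.ball s 1) (Metric.ball_mem_nhds s zero_lt_one)
    ?_ ?_ ?_ ?_ ?_ ?_
  · have h2 := key.2.const_mul (1 / (2 * Real.pi))
    simpa [circleAvg] using h2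
  · exact Filter.eventually_of_mem (Metric.ball_mem_nhds s zero_lt_one) fun x hx => (hcontF x (hball x hx)).aestronglyMeasurable
  · exact (hcontF s ⟨by linarith, by linarith⟩).intervalIntegrable _ _
  · exact hcontF'.aestronglyMeasurable
  · refine Filter.Eventually.of_forall fun θ hθ x hx => ?_
    have hθ' : θ ∈ Icc (0 : ℝ) (2 * Real.pi) := by
      rw [uIoc_of_le (by positivity)] at hθ
      exact ⟨hθ.1.le, hθ.2⟩
    exact (ContinuousLinearMap.le_opNorm _ _).trans (mul_le_mul_of_nonneg_right (hM x (hball x hx) θ hθ') (norm_nonneg _))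
  · exact intervalIntegrable_const
  · exact Filter.Eventually.of_forall fun θ _ x hx =>
      (hdiff x (hball x hx) θ).hasFDerivAt.comp_hasDerivAt x (hasDerivAt_axisPt_height x t θ)

/-- Off the axis: for `t ≠ 0` every circle `axisPt x t ·` lies in the open set `{y | cylRadius y ≠ 0}` (where `eR`, `eTheta`, `radialVelocity`, `swirlVelocity` are smooth
in terms of smooth data). [folklore] -/
theorem axisPt_mem_cylRadius_ne_zero (x : ℝ) {t : ℝ} (ht : t ≠ 0) (θ : ℝ) :
    axisPt x t θ ∈ {y : EuclideanSpace ℝ (Fin 3) | cylRadius y ≠ 0} := by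
  rcases lt_or_gt_of_ne ht with h | h
  · -- `t < 0`: `axisPt x t θ = axisPt x (−t) (θ + π)`, radius `−t > 0`
    have hrad : cylRadius (axisPt x t θ) = -t := by
      obtain ⟨h0, h1, -⟩ := axisPt_apply x t θ
      rw [cylRadius, h0, h1, show (t * Real.cos θ) ^ 2 + (t * Real.sin θ) ^ 2 = (-t) ^ 2 by
        linear_combination t ^ 2 * Real.cos_sq_add_sin_sq θ, Real.sqrt_sq (by linarith)]
    simp only [mem_setOf_eq, hrad]; linarith
  · simp only [mem_setOf_eq, cylRadius_axisPt x h.le θ]; exact h.ne'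

/-- The set `{cylRadius ≠ 0}` is open. [folklore] -/
theorem isOpen_cylRadius_ne_zero : IsOpen {y : EuclideanSpace ℝ (Fin 3) | cylRadius y ≠ 0} :=
  isOpen_ne_fun continuous_cylRadius continuous_const

end Summit.NavierStokesRegularity.NavierStokesRegularity.Theorems.PowerGaugeEulerLiouville.HoopCore

end
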